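import Mathlib
import Summits.Ventures.PercRepro2.SwGlueAll
import Summits.Ventures.PercRepro2.SwAllBlocks
import Summits.Ventures.PercRepro2.SwAllBlocks2
import Summits.Ventures.PercRepro2.SwAllBlocks3
import Summits.Ventures.PercRepro2.SwAllBlocksP1

/-!
# Row 2′SW-ALL is closed under gluing at a vertex (blind cell PercRepro2, night-4 g6, 2026-08-24;
proofs/NIGHT4-G6.md §3; the rigid form of night-4 g4's `Glue.sw_glue_of_sides`)

`swAll_glue_of_sides`: if the rigid row 2′SW-ALL (`LocRows.SwAll`) holds on both sides of a gluing
for every placement of three distinct marks, it holds on the glued graph for every placement.  The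
twenty-seven placements reduce, by the side swap `swAll_glue_swap`, to the seven rigid placement
theorems `swAll_glue_pendant'` (P0, the cut vertex possibly among the marks), `swAll_glue_sep_lo`
(P1, SwAllBlocksP1), `swAll_glue_sep_l` (P2, SwAllBlocks3), `swAll_glue_sep_o` (P3, SwAllBlocks2),
`swAll_glue_cut_o` (P4, SwAllBlocks2), `swAll_glue_cut_l` (P5, SwAllBlocks), `swAll_glue_cut_h`
(P6, SwAllBlocks), and the empty case `h = c` between `l` and `o`.  The rigid conditions move across
the side swap because `within` and the clusters are relabelling-invariant (`mem_within_glue_swap`,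
`cluster_glue_swap`).
-/

namespace Summit.Ventures.PercRepro2

namespace Glue

open Hull LocRows

open scoped Classical

variable {V : Type*} {E₁ E₂ : Type*} {ends₁ : E₁ → Sym2 V} {ends₂ : E₂ → Sym2 V} {c : V}
  {V₁ V₂ : Set V}

/-! ## The side swap -/

/-- The incidence of the glued graph with the sides exchanged. -/
lemma glue_swap_apply (e : E₁ ⊕ E₂) : glue ends₂ ends₁ (Sum.swap e) = glue ends₁ ends₂ e := by
  rcases e with e | e <;> rfl

/-- Edges inside a set are invariant under the side swap. -/
lemma mem_within_glue_swap {S : Set V} (e : E₁ ⊕ E₂) :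
    e ∈ within (glue ends₁ ends₂) S ↔ Sum.swap e ∈ within (glue ends₂ ends₁) S := by
  simp only [within, Set.mem_setOf_eq, glue_swap_apply]

variable [Fintype E₁] [Fintype E₂] [DecidableEq E₁] [DecidableEq E₂]

/-- **Row 2′SW-ALL is invariant under the side swap.** -/
theorem swAll_glue_swap {l h o : V} (hs : SwAll (glue ends₂ ends₁) l h o) :
    SwAll (glue ends₁ ends₂) l h o := by
  obtain ⟨f, hf, hmem⟩ := hs
  refine ⟨fun x => f ⟨x.1 ∘ Sum.swap, (mem_tgtU_glue_swap x.1).1 x.2⟩ ∘ Sum.swap, ?_, ?_⟩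
  · intro x y hxy
    have h1 : f ⟨x.1 ∘ Sum.swap, (mem_tgtU_glue_swap x.1).1 x.2⟩ =
        f ⟨y.1 ∘ Sum.swap, (mem_tgtU_glue_swap y.1).1 y.2⟩ := by
      have this : (f ⟨x.1 ∘ Sum.swap, (mem_tgtU_glue_swap x.1).1 x.2⟩ ∘ Sum.swap) ∘ Sum.swap =
          (f ⟨y.1 ∘ Sum.swap, (mem_tgtU_glue_swap y.1).1 y.2⟩ ∘ Sum.swap) ∘ Sum.swap :=
        congrArg (fun ζ => ζ ∘ Sum.swap) hxy
      rwa [comp_swap_swap', comp_swap_swap'] at this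
    have h2 : x.1 ∘ Sum.swap = y.1 ∘ Sum.swap := congrArg Subtype.val (hf h1)
    apply Subtype.ext
    have this : (x.1 ∘ Sum.swap) ∘ Sum.swap = (y.1 ∘ Sum.swap) ∘ Sum.swap :=
      congrArg (fun ζ => ζ ∘ Sum.swap) h2
    rwa [comp_swap_swap, comp_swap_swap] at this
  · intro x
    obtain ⟨ht, hflip⟩ := hmem ⟨x.1 ∘ Sum.swap, (mem_tgtU_glue_swap x.1).1 x.2⟩
    refine ⟨?_, ?_⟩
    · rw [mem_tgtU_glue_swap, comp_swap_swap']
      exact ht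
    · intro e he hred
      rw [cluster_glue_swap x.1 h, mem_within_glue_swap] at he
      have hred' : (x.1 ∘ Sum.swap) (Sum.swap e) = true := by
        show x.1 (Sum.swap (Sum.swap e)) = true
        rw [Sum.swap_swap]; exact hred
      exact hflip (Sum.swap e) he hred'

/-! ## The pendant placement with the cut vertex among the marks -/

/-- **2′SW-ALL with a pendant side, the cut vertex possibly among the marks**: `l, h, o ∈ V₁`
(any of them may be `c`); the rigid row on the first side gives it on the glued graph. -/
theorem swAll_glue_pendant' {l h o : V} (hg : IsGluing ends₁ ends₂ c V₁ V₂) (hl : l ∈ V₁)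
    (hh : h ∈ V₁) (ho : o ∈ V₁) (h₁ : SwAll ends₁ l h o) : SwAll (glue ends₁ ends₂) l h o := by
  obtain ⟨f₁, hf₁, hmem₁⟩ := h₁
  have key : ∀ ζ : Config (E₁ ⊕ E₂),
      ζ ∈ tgtU (glue ends₁ ends₂) l h {S : Set V | o ∈ S} ↔
        ζ ∘ Sum.inl ∈ tgtU ends₁ l h {S : Set V | o ∈ S} := by
    intro ζ
    rw [mem_tgtU_glue_iff, mem_cluster_glue_iff₁' hg hl hh, mem_cluster_glue_iff₁' hg hl hh,
      mem_cluster_glue_iff₁' hg hl ho, mem_cluster_glue_iff₁' hg hl ho, blue_comp_inl]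
    simp only [tgtU, Finset.mem_filter, Finset.mem_univ, true_and, mem_hull_iff, Set.mem_setOf_eq,
      not_or]
  refine ⟨fun x => pair (f₁ ⟨x.1 ∘ Sum.inl, (key _).1 x.2⟩) (blue (x.1 ∘ Sum.inr)), ?_, ?_⟩
  · intro x y hxy
    have h1 := congrArg (fun ζ => ζ ∘ Sum.inl) hxy
    have h2 := congrArg (fun ζ => ζ ∘ Sum.inr) hxy
    simp only [pair_inl, pair_inr] at h1 h2
    have h1' : x.1 ∘ Sum.inl = y.1 ∘ Sum.inl := congrArg Subtype.val (hf₁ h1)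
    have h2' : x.1 ∘ Sum.inr = y.1 ∘ Sum.inr := by
      have := congrArg blue h2
      simpa only [blue_blue] using this
    apply Subtype.ext
    rw [← pair_comp x.1, ← pair_comp y.1, h1', h2']
  · intro x
    obtain ⟨ht, hflip⟩ := hmem₁ ⟨x.1 ∘ Sum.inl, (key _).1 x.2⟩
    refine ⟨(key _).2 (by rw [pair_inl]; exact ht), ?_⟩
    intro e he hred
    rcases e with e₁ | e₂
    · -- a first-side edge inside the red cluster of `h` is inside its first-side cluster
      have hw : e₁ ∈ within ends₁ (cluster ends₁ (x.1 ∘ Sum.inl) h) := by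
        obtain ⟨a, ⟨ha, haV₁⟩, b, ⟨hb, hbV₁⟩, hends⟩ := mem_within_inl_glue hg he
        exact ⟨a, (mem_cluster_glue_iff₁' hg hh haV₁).1 ha, b,
          (mem_cluster_glue_iff₁' hg hh hbV₁).1 hb, hends⟩
      show f₁ ⟨x.1 ∘ Sum.inl, (key _).1 x.2⟩ e₁ = false
      exact hflip e₁ hw hred
    · exact pair_blue_inr_apply _ _ e₂ hred

/-! ## The empty placement -/

/-- 2′SW-ALL holds vacuously when `Q` is empty. -/
lemma swAll_of_empty {E : Type*} [Fintype E] [DecidableEq E] {ends : E → Sym2 V} {l h o : V}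
    (he : tgtU ends l h {S : Set V | o ∈ S} = ∅) : SwAll ends l h o := by
  refine ⟨fun x => x.1, fun x y hxy => Subtype.ext hxy, fun x => ?_⟩
  exact absurd x.2 (Finset.eq_empty_iff_forall_notMem.1 he x.1)

/-- **`h = c` between `l` and `o`**: `Q(G)` is empty. -/
theorem swAll_glue_cut_h_between {l o : V} (hg : IsGluing ends₁ ends₂ c V₁ V₂) (hl : l ∈ V₁)
    (ho : o ∈ V₂) (hoc : o ≠ c) : SwAll (glue ends₁ ends₂) l c o := by
  apply swAll_of_empty
  rw [Finset.eq_empty_iff_forall_notMem]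
  intro ζ hζ
  rw [mem_tgtU_glue_iff, mem_cluster_glue_iff_across hg hl ho hoc] at hζ
  obtain ⟨⟨h1, _⟩, ⟨h3, _⟩, _⟩ := hζ
  exact h1 ((mem_cluster_glue_c_iff hg hl).2 h3)

/-! ## The assembled statement -/

/-- **Row 2′SW-ALL is closed under gluing at a vertex**: if the rigid row holds on both sides for
every placement of three distinct marks, it holds on the glued graph for every placement of three
distinct marks lying on the sides. -/
theorem swAll_glue_of_sides (hg : IsGluing ends₁ ends₂ c V₁ V₂)
    (hs₁ : ∀ l h o : V, l ≠ h → o ≠ l → o ≠ h → SwAll ends₁ l h o)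
    (hs₂ : ∀ l h o : V, l ≠ h → o ≠ l → o ≠ h → SwAll ends₂ l h o)
    {l h o : V} (hlh : l ≠ h) (hol : o ≠ l) (hoh : o ≠ h)
    (hl : l ∈ V₁ ∨ l ∈ V₂) (hh : h ∈ V₁ ∨ h ∈ V₂) (ho : o ∈ V₁ ∨ o ∈ V₂) :
    SwAll (glue ends₁ ends₂) l h o := by
  have hg' := hg.swap
  by_cases hlc : l = c
  · subst hlc
    rcases hh with hh | hh <;> rcases ho with ho | ho
    · exact swAll_glue_pendant' hg hg.c_mem₁ hh ho (hs₁ _ _ _ hlh hol hoh)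
    · exact swAll_glue_swap (swAll_glue_cut_l hg' ho hol hh (Ne.symm hlh))
    · exact swAll_glue_cut_l hg ho hol hh (Ne.symm hlh)
    · exact swAll_glue_swap (swAll_glue_pendant' hg' hg.c_mem₂ hh ho (hs₂ _ _ _ hlh hol hoh))
  by_cases hhc : h = c
  · subst hhc
    rcases hl with hl | hl <;> rcases ho with ho | ho
    · exact swAll_glue_pendant' hg hl hg.c_mem₁ ho (hs₁ _ _ _ hlh hol hoh)
    · exact swAll_glue_cut_h_between hg hl ho hoh
    · exact swAll_glue_swap (swAll_glue_cut_h_between hg' hl ho hoh)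
    · exact swAll_glue_swap (swAll_glue_pendant' hg' hl hg.c_mem₂ ho (hs₂ _ _ _ hlh hol hoh))
  by_cases hoc : o = c
  · subst hoc
    rcases hl with hl | hl <;> rcases hh with hh | hh
    · exact swAll_glue_pendant' hg hl hh hg.c_mem₁ (hs₁ _ _ _ hlh hol hoh)
    · exact swAll_glue_cut_o hg hl hh hhc
    · exact swAll_glue_swap (swAll_glue_cut_o hg' hl hh hhc)
    · exact swAll_glue_swap (swAll_glue_pendant' hg' hl hh hg.c_mem₂ (hs₂ _ _ _ hlh hol hoh))
  rcases hl with hl | hl <;> rcases hh with hh | hh <;> rcases ho with ho | ho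
  · exact swAll_glue_pendant' hg hl hh ho (hs₁ _ _ _ hlh hol hoh)
  · -- `l, h ∈ V₁`, `o ∈ V₂`: `o` separated from `{l, h}`
    exact swAll_glue_swap
      (swAll_glue_sep_o hg' ho hoc hl hh hhc (hs₁ _ _ _ hlh (Ne.symm hlc) (Ne.symm hhc)))
  · -- `l, o ∈ V₁`, `h ∈ V₂`: P1
    exact swAll_glue_sep_lo hg hl ho hoc hh hhc (hs₁ _ _ _ hlc hol hoc)
  · -- `l ∈ V₁`, `h, o ∈ V₂`: P2
    exact swAll_glue_sep_l hg hl hh hhc ho hoc (hs₂ _ _ _ (Ne.symm hhc) hoc hoh)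
  · -- `l ∈ V₂`, `h, o ∈ V₁`: P2 swapped
    exact swAll_glue_swap (swAll_glue_sep_l hg' hl hh hhc ho hoc (hs₁ _ _ _ (Ne.symm hhc) hoc hoh))
  · -- `l, o ∈ V₂`, `h ∈ V₁`: P1 swapped
    exact swAll_glue_swap (swAll_glue_sep_lo hg' hl ho hoc hh hhc (hs₂ _ _ _ hlc hol hoc))
  · -- `l, h ∈ V₂`, `o ∈ V₁`: P3
    exact swAll_glue_sep_o hg ho hoc hl hh hhc (hs₂ _ _ _ hlh (Ne.symm hlc) (Ne.symm hhc))
  · exact swAll_glue_swap (swAll_glue_pendant' hg' hl hh ho (hs₂ _ _ _ hlh hol hoh))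

end Glue

end Summit.Ventures.PercRepro2
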